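import Mathlib
import Summits.ValiantsHypothesis.ValiantsHypothesis.Theorems.NewtonUnitEquationsTwoProductsRankOneFourLawPlanar
import Summits.ValiantsHypothesis.ValiantsHypothesis.Theorems.TwoProducts.Negative.ClassCoverSharedAlphabet
import Summits.ValiantsHypothesis.ValiantsHypothesis.Theorems.TwoProducts.Negative.TwoSidedShapeEscapes
import HarnessLib

/-!
# `TwoProducts` (stmt-ValiantsHypothesis-5906), line `relation_ladder` — NEGATIVE lane: the UNIT shape `α + β = γ + δ + ε`
# escapes every datum supported on at most two letters per side, and every one-sided datum

Helper file of the Negative lane (val-neg-1 g4; `--supports stmt-ValiantsHypothesis-5906`; closes NO item).  Kernel form of family (iv)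
of the first-inhabitant memo (evidence #44 on the item, §1 (iv)): a SHARED alphabet `A l = E` containing five distinct non-zero letters with
the unit relation `α + β = γ + δ + ε`, three distinct positions (`m ≥ 3`).  The coincidence `(α | β | 0) ~ (γ | δ | ε)` has letter multisets
`P = e_α + e_β`, `Q = e_γ + e_δ + e_ε`: two `P`-excess letters and THREE `Q`-excess letters.  A `k`-shift `P + k•ρ⁺ = Q + k•ρ⁻` (or
swapped) transports the three `Q`-excess letters into one strict-excess set of the datum, so:

* `no_shift_of_three_excess` / `no_narrow_datum` — no datum both of whose strict-excess sets `{ρ⁺ < ρ⁻}`, `{ρ⁻ < ρ⁺}` contain at most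
  two letters fits; in particular (`narrow_of_pair`) NO datum of the form `(r•e_γ' + s•e_δ', p•e_α' + q•e_β')` — any letters, any
  coefficients, zero allowed — fits: this covers R6 (`FourTermRankOne`), R6b–R7c, and every conceivable FOUR-LETTER two-sided rung (e.g. a
  rung for the shape `α + 2β = γ + δ` of `…Negative.TwoSidedShapeEscapes`), uniformly (`no_pair_datum`).
* `no_monomial_datum` — no datum with a monomial side `p•e_α'` (either orientation) fits: this is every one-sided datum (R8's
  `OneSidedRankOne`, any number of plus-letters), by `TwoSidedEscape.no_shift_of_oneSided` (two excess letters on each side suffice).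
* `escapes_rankOne_rungs_iv`: all seven `¬`-clauses of `ResidualLawV20` (skeleton v20, bodies verbatim), the typed R8 target, and «no datum
  on two letters per side» hold for the family, as one conjunction; `example_escapes_iv`: `γ = (1,1), δ = (2,1), ε = (4,1), α = (3,1),
  β = (4,2)` on `Fin 3`.

READING (information for the line owner, not an objection): by the same count the unit shape with `n` letters against `n + 1` letters
escapes every datum supported on `≤ n` letters on each side, for every `n` — no finite list of fixed-support rank-one rungs exhausts the
one-relation families; a rung SCHEMA quantified over the supports `(ρ⁺, ρ⁻)` themselves is what the residual asks for.  Honest framing: `TwoProducts` (5906), the residual LAW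
and VP ≠ VNP are NOT proved here and are not claimed. [folklore]
-/

namespace Summit.ValiantsHypothesis.Theorems.TwoProducts.Negative.UnitTwoThreeEscape

open Finset
open Summit.ValiantsHypothesis.ValiantsHypothesis.Theorems.NewtonUnitEquations.TwoProducts.FormalLogLinearisation (Expo)
open Summit.ValiantsHypothesis.ValiantsHypothesis.Theorems.NewtonUnitEquations.TwoProducts.PlanarCell (tuples)
open Summit.ValiantsHypothesis.ValiantsHypothesis.Theorems.NewtonUnitEquations.TwoProducts.PermutationType
  (msetT RankOneCoincidences)
open Summit.ValiantsHypothesis.Theorems.TwoProducts.Negative.ClassCoverBound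
open Summit.ValiantsHypothesis.Theorems.TwoProducts.Negative.TwoSidedEscape

variable {m : ℕ}

/-! ### Datum-level obstruction: three excess letters on one side of a coincidence -/

/- A datum `(ρp, ρm)` is «narrow» on the `ρp < ρm` side when any three letters with `ρp < ρm` contain two equal ones,
i.e. `∀ e₁ e₂ e₃, ρp e₁ < ρm e₁ → ρp e₂ < ρm e₂ → ρp e₃ < ρm e₃ → e₁ = e₂ ∨ e₁ = e₃ ∨ e₂ = e₃` (spelled out below; no new `def`). -/

/-- **Three excess letters need a wide datum.**  If `P < Q` at three distinct letters, no `k`-shift relates `P, Q` to a datum that is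
narrow on both sides. [folklore] -/
theorem no_shift_of_three_excess {P Q ρp ρm : Expo →₀ ℕ} {f₁ f₂ f₃ : Expo} (h₁₂ : f₁ ≠ f₂) (h₁₃ : f₁ ≠ f₃) (h₂₃ : f₂ ≠ f₃)
    (hf₁ : P f₁ < Q f₁) (hf₂ : P f₂ < Q f₂) (hf₃ : P f₃ < Q f₃)
    (hA : ∀ e₁ e₂ e₃ : Expo, ρp e₁ < ρm e₁ → ρp e₂ < ρm e₂ → ρp e₃ < ρm e₃ → e₁ = e₂ ∨ e₁ = e₃ ∨ e₂ = e₃)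
    (hB : ∀ e₁ e₂ e₃ : Expo, ρm e₁ < ρp e₁ → ρm e₂ < ρp e₂ → ρm e₃ < ρp e₃ → e₁ = e₂ ∨ e₁ = e₃ ∨ e₂ = e₃) (k : ℕ) :
    ¬ (P + k • ρp = Q + k • ρm ∨ Q + k • ρp = P + k • ρm) := by
  have ev : ∀ {X Y : Expo →₀ ℕ}, X + k • ρp = Y + k • ρm → ∀ e, X e + k * ρp e = Y e + k * ρm e := fun h e => by
    have := DFunLike.congr_fun h e
    simpa only [Finsupp.add_apply, Finsupp.smul_apply, smul_eq_mul] using this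
  rintro (h | h)
  · rcases hB f₁ f₂ f₃ (lt_of_shift (ev h f₁).symm hf₁) (lt_of_shift (ev h f₂).symm hf₂) (lt_of_shift (ev h f₃).symm hf₃)
      with h | h | h
    exacts [h₁₂ h, h₁₃ h, h₂₃ h]
  · rcases hA f₁ f₂ f₃ (lt_of_shift (ev h f₁) hf₁) (lt_of_shift (ev h f₂) hf₂) (lt_of_shift (ev h f₃) hf₃) with h | h | h
    exacts [h₁₂ h, h₁₃ h, h₂₃ h]

/-- A strict excess over `ρ` of a two-letter combination `p•e_c + q•e_d` sits at `c` or `d`. [folklore] -/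
theorem mem_pair_of_lt (ρ : Expo →₀ ℕ) {c d : Expo} {p q : ℕ} {e : Expo}
    (h : ρ e < (Finsupp.single c p + Finsupp.single d q : Expo →₀ ℕ) e) : e = c ∨ e = d := by
  by_contra hne
  rw [not_or] at hne
  rw [Finsupp.add_apply, Finsupp.single_apply, Finsupp.single_apply, if_neg (Ne.symm hne.1), if_neg (Ne.symm hne.2)] at h
  omega

/-- A datum side supported on two letters is narrow. [folklore] -/
theorem narrow_of_pair (ρ : Expo →₀ ℕ) (c d : Expo) (p q : ℕ) :
    ∀ e₁ e₂ e₃ : Expo, ρ e₁ < (Finsupp.single c p + Finsupp.single d q : Expo →₀ ℕ) e₁ →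
      ρ e₂ < (Finsupp.single c p + Finsupp.single d q : Expo →₀ ℕ) e₂ →
      ρ e₃ < (Finsupp.single c p + Finsupp.single d q : Expo →₀ ℕ) e₃ → e₁ = e₂ ∨ e₁ = e₃ ∨ e₂ = e₃ := by
  intro e₁ e₂ e₃ h₁ h₂ h₃
  rcases mem_pair_of_lt ρ h₁ with h₁ | h₁ <;> rcases mem_pair_of_lt ρ h₂ with h₂ | h₂ <;>
    rcases mem_pair_of_lt ρ h₃ with h₃ | h₃ <;> simp [h₁, h₂, h₃]

/-! ### The unit family `α + β = γ + δ + ε` -/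

section UnitTwoThree

variable {E : Finset Expo} {A : Fin m → Finset Expo} (hA : ∀ l, A l = E) {α β γ δ ε : Expo}
  (hα : α ∈ E) (hβ : β ∈ E) (hγ : γ ∈ E) (hδ : δ ∈ E) (hε : ε ∈ E)
  (hα0 : α ≠ 0) (hβ0 : β ≠ 0) (hγ0 : γ ≠ 0) (hδ0 : δ ≠ 0) (hε0 : ε ≠ 0)
  (hαβ : α ≠ β) (hαγ : α ≠ γ) (hαδ : α ≠ δ) (hαε : α ≠ ε) (hβγ : β ≠ γ) (hβδ : β ≠ δ) (hβε : β ≠ ε)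
  (hγδ : γ ≠ δ) (hγε : γ ≠ ε) (hδε : δ ≠ ε)
  (hrel : α + β = γ + δ + ε) {i j k : Fin m} (hij : i ≠ j) (hik : i ≠ k) (hjk : j ≠ k)
include hA hα hβ hγ hδ hε hα0 hβ0 hγ0 hδ0 hε0 hrel hij hik hjk

/-- **Master lemma of the family**: every datum satisfying `RankOneCoincidences` relates `P = e_α + e_β` and `Q = e_γ + e_δ + e_ε` by a
`k`-shift. [folklore] -/
theorem shift_of_rankOne_iv {ρp ρm : Expo →₀ ℕ} (h : RankOneCoincidences A ρp ρm) :
    ∃ k : ℕ, (Finsupp.single α 1 + Finsupp.single β 1 : Expo →₀ ℕ) + k • ρp =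
        (Finsupp.single γ 1 + Finsupp.single δ 1 + Finsupp.single ε 1) + k • ρm ∨
      (Finsupp.single γ 1 + Finsupp.single δ 1 + Finsupp.single ε 1 : Expo →₀ ℕ) + k • ρp =
        (Finsupp.single α 1 + Finsupp.single β 1) + k • ρm := by
  have ha := triple_mem_tuples hij hik hjk hA (Finset.mem_insert_of_mem hα) (Finset.mem_insert_of_mem hβ)
    (Finset.mem_insert_self (0 : Expo) E)
  have hb := triple_mem_tuples hij hik hjk hA (Finset.mem_insert_of_mem hγ) (Finset.mem_insert_of_mem hδ)
    (Finset.mem_insert_of_mem hε)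
  have hsum : ∑ l, (Pi.single i α + Pi.single j β + Pi.single k (0 : Expo) : Fin m → Expo) l =
      ∑ l, (Pi.single i γ + Pi.single j δ + Pi.single k ε : Fin m → Expo) l := by
    rw [sum_triple, sum_triple, add_zero, hrel]
  have hPa : msetT (Pi.single i α + Pi.single j β + Pi.single k (0 : Expo) : Fin m → Expo) =
      Finsupp.single α 1 + Finsupp.single β 1 := by
    rw [msetT_triple hij hik hjk, if_neg hα0, if_neg hβ0, if_pos rfl, add_zero]
  have hPb : msetT (Pi.single i γ + Pi.single j δ + Pi.single k ε : Fin m → Expo) =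
      Finsupp.single γ 1 + Finsupp.single δ 1 + Finsupp.single ε 1 := by
    rw [msetT_triple hij hik hjk, if_neg hγ0, if_neg hδ0, if_neg hε0]
  obtain ⟨k, hk⟩ := h _ ha _ hb hsum
  rw [hPa, hPb] at hk
  exact ⟨k, hk⟩

include hαγ hαδ hαε hβγ hβδ hβε hγδ hγε hδε in
/-- **No narrow datum fits the unit family** (both strict-excess sets of the datum have at most two letters). [folklore] -/
theorem no_narrow_datum (ρp ρm : Expo →₀ ℕ)
    (hAn : ∀ e₁ e₂ e₃ : Expo, ρp e₁ < ρm e₁ → ρp e₂ < ρm e₂ → ρp e₃ < ρm e₃ → e₁ = e₂ ∨ e₁ = e₃ ∨ e₂ = e₃)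
    (hBn : ∀ e₁ e₂ e₃ : Expo, ρm e₁ < ρp e₁ → ρm e₂ < ρp e₂ → ρm e₃ < ρp e₃ → e₁ = e₂ ∨ e₁ = e₃ ∨ e₂ = e₃) :
    ¬ RankOneCoincidences A ρp ρm := by
  intro h
  obtain ⟨k, hk⟩ := shift_of_rankOne_iv hA hα hβ hγ hδ hε hα0 hβ0 hγ0 hδ0 hε0 hrel hij hik hjk h
  refine no_shift_of_three_excess (f₁ := γ) (f₂ := δ) (f₃ := ε) hγδ hγε hδε ?_ ?_ ?_ hAn hBn k hk
  · simp [Ne.symm hαγ, Ne.symm hβγ, hγδ, hγε]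
  · simp [Ne.symm hαδ, Ne.symm hβδ, Ne.symm hγδ, hδε]
  · simp [Ne.symm hαε, Ne.symm hβε, Ne.symm hγε, Ne.symm hδε]

include hαγ hαδ hαε hβγ hβδ hβε hγδ hγε hδε in
/-- **No datum supported on two letters per side fits** — any letters `α' β' γ' δ'`, any coefficients (zero allowed): R6, R6b–R7c and
every four-letter two-sided rung shape at once. [folklore] -/
theorem no_pair_datum (α' β' γ' δ' : Expo) (p q r s : ℕ) :
    ¬ RankOneCoincidences A (Finsupp.single γ' r + Finsupp.single δ' s) (Finsupp.single α' p + Finsupp.single β' q) :=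
  no_narrow_datum hA hα hβ hγ hδ hε hα0 hβ0 hγ0 hδ0 hε0 hαγ hαδ hαε hβγ hβδ hβε hγδ hγε hδε hrel hij hik hjk _ _
    (narrow_of_pair _ α' β' p q) (narrow_of_pair _ γ' δ' r s)

include hαβ hαγ hαδ hαε hβγ hβδ hβε hγδ hγε hδε in
/-- **No datum with a monomial side `p•e_α'` fits the unit family** (either orientation; this is every ONE-SIDED datum: R6b–R7c and the
typed R8 target with any number of plus-letters) — two excess letters on each side of the coincidence already suffice
(`TwoSidedEscape.no_shift_of_oneSided`). [folklore] -/
theorem no_monomial_datum (α' : Expo) (p : ℕ) (ρ : Expo →₀ ℕ) :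
    ¬ RankOneCoincidences A ρ (Finsupp.single α' p) ∧ ¬ RankOneCoincidences A (Finsupp.single α' p) ρ := by
  have key : ∀ ρp ρm : Expo →₀ ℕ, ((∀ e e', ρp e < ρm e → ρp e' < ρm e' → e = e') ∨
      (∀ e e', ρm e < ρp e → ρm e' < ρp e' → e = e')) → ¬ RankOneCoincidences A ρp ρm := by
    intro ρp ρm hone h
    obtain ⟨k, hk⟩ := shift_of_rankOne_iv hA hα hβ hγ hδ hε hα0 hβ0 hγ0 hδ0 hε0 hrel hij hik hjk h
    refine no_shift_of_oneSided (e₁ := α) (e₂ := β) (f₁ := γ) (f₂ := δ) hαβ hγδ ?_ ?_ ?_ ?_ hone k hk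
    · simp [hαβ, hαγ, hαδ, hαε]
    · simp [Ne.symm hαβ, hβγ, hβδ, hβε]
    · simp [Ne.symm hαγ, Ne.symm hβγ, hγδ, hγε]
    · simp [Ne.symm hαδ, Ne.symm hβδ, Ne.symm hγδ, hδε]
  exact ⟨key _ _ (Or.inl (oneSided_of_single_right ρ α' p)), key _ _ (Or.inr (oneSided_of_single_left ρ α' p))⟩

include hαβ hαγ hαδ hαε hβγ hβδ hβε hγδ hγε hδε in
/-- **The unit family survives every rank-one rung typed so far AND any four-letter rung**: the seven `¬`-clauses of `ResidualLawV20`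
(bodies verbatim, skeleton v20 order: `FourTermRankOne`, `ThreeTermRankOne`, `ThreeTermAPRankOne`, `ThreeTermFreeRankOne`,
`ThreeTermHomRankOne`, `ThreeTermGenRankOne`, `TwoTermRankOne`), then `¬ OneSidedRankOne` (typed R8 target, verbatim), then — new for
this family, and FALSE for the shape `α + 2β = γ + δ` — no datum at all on two letters per side (any letters, any coefficients). [folklore] -/
theorem escapes_rankOne_rungs_iv :
    (¬ ∃ α β γ δ : Expo, α ≠ β ∧ α ≠ γ ∧ α ≠ δ ∧ β ≠ γ ∧ β ≠ δ ∧ γ ≠ δ ∧ α + β = γ + δ ∧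
        RankOneCoincidences A (Finsupp.single γ 1 + Finsupp.single δ 1) (Finsupp.single α 1 + Finsupp.single β 1)) ∧
    (¬ ∃ α β γ : Expo, α ≠ β ∧ α ≠ γ ∧ β ≠ γ ∧ α = β + γ ∧
        RankOneCoincidences A (Finsupp.single β 1 + Finsupp.single γ 1) (Finsupp.single α 1)) ∧
    (¬ ∃ α β γ : Expo, α ≠ β ∧ α ≠ γ ∧ β ≠ γ ∧ α + γ = β + β ∧
        RankOneCoincidences A (Finsupp.single β 2) (Finsupp.single α 1 + Finsupp.single γ 1)) ∧
    (¬ ∃ (α β γ : Expo) (q r : ℕ), 1 ≤ q ∧ 1 ≤ r ∧ α ≠ β ∧ α ≠ γ ∧ β ≠ γ ∧ α = q • β + r • γ ∧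
        RankOneCoincidences A (Finsupp.single β q + Finsupp.single γ r) (Finsupp.single α 1)) ∧
    (¬ ∃ α β γ : Expo, ∃ q r : ℕ, α ≠ β ∧ α ≠ γ ∧ β ≠ γ ∧ 1 ≤ q ∧ 1 ≤ r ∧ q • α + r • γ = (q + r) • β ∧
        RankOneCoincidences A (Finsupp.single β (q + r)) (Finsupp.single α q + Finsupp.single γ r)) ∧
    (¬ ∃ (α β γ : Expo) (p q r : ℕ), 1 ≤ p ∧ 1 ≤ q ∧ 1 ≤ r ∧ α ≠ β ∧ α ≠ γ ∧ β ≠ γ ∧ p • α = q • β + r • γ ∧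
        RankOneCoincidences A (Finsupp.single β q + Finsupp.single γ r) (Finsupp.single α p)) ∧
    (¬ ∃ (α β : Expo) (p q : ℕ), 1 ≤ p ∧ 1 ≤ q ∧ α ≠ β ∧ p • α = q • β ∧
        RankOneCoincidences A (Finsupp.single β q) (Finsupp.single α p)) ∧
    (¬ ∃ (α : Expo) (p k : ℕ) (β : Fin k → Expo) (q : Fin k → ℕ), 1 ≤ p ∧ 1 ≤ k ∧ (∀ i, 1 ≤ q i) ∧ Function.Injective β ∧
        (∀ i, β i ≠ α) ∧ p • α = ∑ i, q i • β i ∧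
        RankOneCoincidences A (∑ i, Finsupp.single (β i) (q i)) (Finsupp.single α p)) ∧
    (¬ ∃ (α β γ δ : Expo) (p q r s : ℕ),
        RankOneCoincidences A (Finsupp.single γ r + Finsupp.single δ s) (Finsupp.single α p + Finsupp.single β q)) := by
  have NP := no_pair_datum hA hα hβ hγ hδ hε hα0 hβ0 hγ0 hδ0 hε0 hαγ hαδ hαε hβγ hβδ hβε hγδ hγε hδε hrel hij hik hjk
  have NM := no_monomial_datum hA hα hβ hγ hδ hε hα0 hβ0 hγ0 hδ0 hε0 hαβ hαγ hαδ hαε hβγ hβδ hβε hγδ hγε hδε hrel hij hik hjk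
  refine ⟨?_, ?_, ?_, ?_, ?_, ?_, ?_, ?_, ?_⟩
  · rintro ⟨a, b, c, d, -, -, -, -, -, -, -, hR⟩
    exact NP a b c d 1 1 1 1 hR
  · rintro ⟨a, b, c, -, -, -, -, hR⟩
    exact (NM a 1 _).1 hR
  · rintro ⟨a, b, c, -, -, -, -, hR⟩
    exact (NM b 2 _).2 hR
  · rintro ⟨a, b, c, q, r, -, -, -, -, -, -, hR⟩
    exact (NM a 1 _).1 hR
  · rintro ⟨a, b, c, q, r, -, -, -, -, -, -, hR⟩
    exact (NM b (q + r) _).2 hR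
  · rintro ⟨a, b, c, p, q, r, -, -, -, -, -, -, -, hR⟩
    exact (NM a p _).1 hR
  · rintro ⟨a, b, p, q, -, -, -, -, hR⟩
    exact (NM a p _).1 hR
  · rintro ⟨a, p, n, b, q, -, -, -, -, -, -, hR⟩
    exact (NM a p _).1 hR
  · rintro ⟨a, b, c, d, p, q, r, s, hR⟩
    exact NP a b c d p q r s hR

end UnitTwoThree

/-! ### Non-vacuity of the letter hypotheses: `γ = (1,1), δ = (2,1), ε = (4,1), α = (3,1), β = (4,2)` on `Fin 3` -/

/-- The concrete unit alphabet (`α + β = γ + δ + ε = (7,3)`) escapes every datum supported on two letters per side. [folklore] -/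
theorem example_escapes_iv (α' β' γ' δ' : Expo) (p q r s : ℕ) :
    ¬ RankOneCoincidences
      (fun _ : Fin 3 => ({Finsupp.single 0 3 + Finsupp.single 1 1, Finsupp.single 0 4 + Finsupp.single 1 2,
        Finsupp.single 0 1 + Finsupp.single 1 1, Finsupp.single 0 2 + Finsupp.single 1 1,
        Finsupp.single 0 4 + Finsupp.single 1 1} : Finset Expo))
      (Finsupp.single γ' r + Finsupp.single δ' s) (Finsupp.single α' p + Finsupp.single β' q) := by
  refine no_pair_datum
    (E := {Finsupp.single 0 3 + Finsupp.single 1 1, Finsupp.single 0 4 + Finsupp.single 1 2,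
        Finsupp.single 0 1 + Finsupp.single 1 1, Finsupp.single 0 2 + Finsupp.single 1 1, Finsupp.single 0 4 + Finsupp.single 1 1})
    (fun _ => rfl) (α := Finsupp.single 0 3 + Finsupp.single 1 1) (β := Finsupp.single 0 4 + Finsupp.single 1 2)
    (γ := Finsupp.single 0 1 + Finsupp.single 1 1) (δ := Finsupp.single 0 2 + Finsupp.single 1 1)
    (ε := Finsupp.single 0 4 + Finsupp.single 1 1) (by simp) (by simp) (by simp) (by simp) (by simp)
    ?_ ?_ ?_ ?_ ?_ ?_ ?_ ?_ ?_ ?_ ?_ ?_ ?_ ?_ ?_ (i := 0) (j := 1) (k := 2) (by decide) (by decide) (by decide)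
    α' β' γ' δ' p q r s
  all_goals
    first
      | (intro h; have h0 := DFunLike.congr_fun h 0; have h1 := DFunLike.congr_fun h 1;
          simp at h0 h1)
      | (ext s; fin_cases s <;> simp)

end Summit.ValiantsHypothesis.Theorems.TwoProducts.Negative.UnitTwoThreeEscape
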